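import Summits.CriticalPhenomena.SAWScalingLimit.Theses.SAWRenewalTightness
import Summits.CriticalPhenomena.SAWScalingLimit.Theses.SAWRestrictionRigidity
import Summits.CriticalPhenomena.SAWScalingLimit.Theses.SAWWeldingIdentification
import Summits.CriticalPhenomena.SAWScalingLimit.Theorems.SAWRenewalTightnessEventualTightOfBoundedVirginArc
import Summits.CriticalPhenomena.SAWScalingLimit.Theorems.SAWRenewalTightnessEventualTightOfBoundaryBulk
import Summits.CriticalPhenomena.SAWScalingLimit.Theorems.SAWRenewalTightnessEventualTightOfBoundaryRepulsion

/-!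
# `EventualTight` (stmt-CriticalPhenomena-1372) from its E-free children, BY ITEM NAME — wiring of line `Sketch` v14

Lead c14 of the crux chain (2026-08-17).  The line of record `Cruxes/EventualTight/Lines/Sketch.lean` was reshaped (registration v14)
to the E-free stub set {X2c₁ᵇ `stub_virginArcTraversalTightBounded` = item stmt-CriticalPhenomena-18042 =
`Theses.SAWWeldingIdentification.VirginArcTraversalTightBounded`, B `stub_boundaryShellTight` = item stmt-CriticalPhenomena-19311 =
`Theses.SAWRenewalTightness.BoundaryShellTight`}, the boundary leaf B replacing the restriction-positivity leaf E
(`ConfinementPositivity`, stmt-17587).  All the mathematics is landed (`…EventualTightOfBoundedVirginArc.lean` p151500,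
`…EventualTightOfBoundaryBulk.lean` p172517, `…EventualTightOfBoundaryRepulsion.lean` p173003); those files speak of
`Theorems.TPToTraversalBound.Radial.BoundaryShellTight` and of unfolded signatures.  This file records the same implications against the
ROUTE ITEM DECLS by name (all bodies are syntactically identical, so every proof is a direct term), so that the gate can close the crux from
`VirginArcTraversalTightBounded_holds` and `BoundaryShellTight_holds` the moment the two items land, for each of the three route copies of
the crux decl, and so that the by-name status of the new item stmt-19311 (crux-implied, summit-implied, implied by the strategist's one-scale
atom BR given the bulk atom) is visible in `Theorems/`:

* `eventualTight_of_itemsV14` (`_restriction`, `_welding`): 18042 → 19311 → crux;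
* `eventualTight_iff_bulkShellTight_and_boundaryShellTight_item`: crux ↔ 17588 ∧ 19311 (exact residual);
* `boundaryShellTight_item_of_eventualTight`, `boundaryShellTight_item_of_sawScalingLimit`: 19311 is crux- and summit-implied;
* `boundaryShellTight_item_of_boundaryRepulsion_of_virginArcTraversalTightBounded`: 19311 ⟸ BR ∧ 18042.
-/

namespace Summit.CriticalPhenomena.SAWScalingLimit.Theorems

open MeasureTheory Set Metric
open scoped ENNReal unitInterval
open Literature.Probability.RandomPlanarGeometry Literature.Probability.LatticeModels
open Summit.CriticalPhenomena.SAWScalingLimit.Theses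

/-- **Crux from its E-free children, by item name** (line `Sketch` v14): the bulk atom X2c₁ᵇ (item stmt-18042,
`SAWWeldingIdentification.VirginArcTraversalTightBounded`) and frontier-shell count tightness B (item stmt-19311,
`SAWRenewalTightness.BoundaryShellTight`) give `SAWRenewalTightness.EventualTight`
(`eventualTight_of_virginArcTraversalTightBounded_of_boundaryShellTight`, p172517, read at the item decls). [folklore] -/
theorem eventualTight_of_itemsV14 (hXb : SAWWeldingIdentification.VirginArcTraversalTightBounded)
    (hB : SAWRenewalTightness.BoundaryShellTight) : SAWRenewalTightness.EventualTight :=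
  eventualTight_of_virginArcTraversalTightBounded_of_boundaryShellTight hXb hB

/-- The same composition concluding the `SAWRestrictionRigidity` copy of the crux decl (the crux item's recorded `crux_decl`;
syntactically identical body). [folklore] -/
theorem eventualTight_restriction_of_itemsV14 (hXb : SAWWeldingIdentification.VirginArcTraversalTightBounded)
    (hB : SAWRenewalTightness.BoundaryShellTight) : SAWRestrictionRigidity.EventualTight :=
  eventualTight_of_virginArcTraversalTightBounded_of_boundaryShellTight hXb hB

/-- The same composition concluding the bet route's copy `SAWWeldingIdentification.EventualTight`. [folklore] -/
theorem eventualTight_welding_of_itemsV14 (hXb : SAWWeldingIdentification.VirginArcTraversalTightBounded)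
    (hB : SAWRenewalTightness.BoundaryShellTight) : SAWWeldingIdentification.EventualTight :=
  eventualTight_of_virginArcTraversalTightBounded_of_boundaryShellTight hXb hB

/-- **Exact residual, by item name**: `EventualTight ↔ BulkShellTight ∧ BoundaryShellTight` with the route item decls
stmt-17588 and stmt-19311 (`eventualTight_iff_bulkShellTight_and_boundaryShellTight`, p172517). [folklore] -/
theorem eventualTight_iff_bulkShellTight_and_boundaryShellTight_item :
    SAWRenewalTightness.EventualTight ↔
      (SAWRenewalTightness.BulkShellTight ∧ SAWRenewalTightness.BoundaryShellTight) :=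
  eventualTight_iff_bulkShellTight_and_boundaryShellTight

/-- **Item stmt-19311 is crux-implied** (`boundaryShellTight_of_eventualTight`, read at the item decl): no refutation risk beyond
the crux. [folklore] -/
theorem boundaryShellTight_item_of_eventualTight (hT : SAWRenewalTightness.EventualTight) :
    SAWRenewalTightness.BoundaryShellTight :=
  boundaryShellTight_of_eventualTight hT

/-- **Item stmt-19311 is summit-implied** (`boundaryShellTight_of_sawScalingLimit`): false only if `SAWScalingLimit` is. [folklore] -/
theorem boundaryShellTight_item_of_sawScalingLimit (h : SAW.SAWScalingLimit) : SAWRenewalTightness.BoundaryShellTight :=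
  boundaryShellTight_of_sawScalingLimit h

/-- **¬ stmt-19311 refutes the crux** (contrapositive, by item name). [folklore] -/
theorem not_eventualTight_of_not_boundaryShellTight_item (h : ¬ SAWRenewalTightness.BoundaryShellTight) :
    ¬ SAWRenewalTightness.EventualTight :=
  fun hT => h (boundaryShellTight_of_eventualTight hT)

/-- **Item stmt-19311 from the strategist's one-scale boundary atom BR and the bulk atom** (item stmt-18042): collar avoidance off
the sockets (`Lines/boundary_repulsion`) plus X2c₁ᵇ give frontier-shell count tightness
(`boundaryShellTight_of_boundaryRepulsion_of_bulkShellTight`, p173003, over `bulkShellTight_of_virginArcTraversalTightBounded`,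
p151500).  So on line `Sketch` v14 the registered boundary stub is weaker than BR given the registered bulk stub. [folklore] -/
theorem boundaryShellTight_item_of_boundaryRepulsion_of_virginArcTraversalTightBounded
    (hBR : ∀ (D : DobrushinDomain) (a b : ℝ → Site 2), SAW.IsEndpointApprox D a b →
      ∀ d : ℝ, 0 < d → ∀ ε : ℝ, 0 < ε → ∃ (s δ₁ : ℝ), 0 < s ∧ 0 < δ₁ ∧ ∀ δ ∈ Set.Ioc (0 : ℝ) δ₁,
        SAW.law D.carrier δ (a δ) (b δ)
          {γ | ∃ t : I, d ≤ dist ((⟨γ.walk.toCurve (meshPoint δ)⟩ : Curve ℂ) t) (D.pt 0) ∧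
                d ≤ dist ((⟨γ.walk.toCurve (meshPoint δ)⟩ : Curve ℂ) t) (D.pt 1) ∧
                Metric.infDist ((⟨γ.walk.toCurve (meshPoint δ)⟩ : Curve ℂ) t) D.carrierᶜ ≤ s} ≤
          ENNReal.ofReal ε)
    (hXb : SAWWeldingIdentification.VirginArcTraversalTightBounded) : SAWRenewalTightness.BoundaryShellTight :=
  boundaryShellTight_of_boundaryRepulsion_of_bulkShellTight hBR (bulkShellTight_of_virginArcTraversalTightBounded hXb)

/-- **The bulk child from the bulk atom, by item name**: stmt-18042 gives stmt-17588 (`bulkShellTight_of_virginArcTraversalTightBounded`,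
p151500, read at the item decls). [folklore] -/
theorem bulkShellTight_item_of_virginArcTraversalTightBounded_item
    (hXb : SAWWeldingIdentification.VirginArcTraversalTightBounded) : SAWRenewalTightness.BulkShellTight :=
  bulkShellTight_of_virginArcTraversalTightBounded hXb

end Summit.CriticalPhenomena.SAWScalingLimit.Theorems
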